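/-
Origin: expansion seat `prover-pub-hodgecm-mc-carch-1-0`, handover #CA2 2026-08-19T22:09Z md5 9df1688c32f4 (213 l.; NEW additive leaf; imports Model.ArchKTypePinTensor, Model.HypCensus.ArchDatumCM, Model.WmInstanceV2, Vendored…GelbartRogawski1991.UnitaryDualPairThetaKernelCMKType, Vendored…Automorphic.UnitaryGroupArchSection) (`HOME/mc/pub-hodgecm-mc-carch-1/pkg/HodgeCM/Model/ArchKTypeOfArch.lean`, md5 9df1688c, 213 lines);
landed by the gen-13 packager (p-g13) in gate run 37 as `HodgeCM/Model/ArchKTypeOfArch.lean` (verbatim).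
-/
/-
Copyright (c) 2026. Released under Apache 2.0 license as described in the file LICENSE.
Cell pub-hodgecm, MODEL layer (construction prover mc-carch-1, gen 0), BINDER-OWNERS row 12 `C` / node W6a (W-⊗′) of
`MODEL-DAG.md`: the archimedean factor `ωA` of the honest pair action along the `ι₁`-section, i.e. the discharger of the
junction `hA` of `Model/ArchKTypeOf.archKTypeOf` up to the line collapse.
-/
import Summits.HodgeConjecture.HodgeCM.Model.ArchKTypePinTensor
import Summits.HodgeConjecture.HodgeCM.Model.HypCensus.ArchDatumCM
import Summits.HodgeConjecture.HodgeCM.Model.WmInstanceV2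
import Literature.NumberTheory.GelbartRogawski1991.UnitaryDualPairThetaKernelCMKType
import Literature.NumberTheory.Automorphic.UnitaryGroupArchSection

/-!
# The pair action at archimedean elements is pure-tensor, and the archimedean section in the CM frame

`Model/ArchKTypeOf.archKTypeOf` asks for (junction `hA`) an archimedean representation `ωA` of `U(2,1)` with
`(S.P k).ω (S.ιinf g, 1) = ωA g ⊗ 1` (`adelicTensorEnd (ωA g) LinearMap.id`).  At the honest adelic side
(`S.P k).ω = lineRepOf k` (period-1 `Model/ArchSideTerm`, RUN 37) = a unit scalar times `cmPairRep e₁ hGR_k` of the line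
pair (tree Collapse p194071 `cm(Conj)LineRepFin_k_apply_eq_smul_cmPairRep`), and `S.ιinf = archInfOf V` (#1097) is the
archimedean SECTION at `ι₁` read through the rational CM frame `frameG V`.  This file supplies the two generic facts
that turn that into `hA`:

* § 1 **`cmPairRep_archToAdelic_eq_adelicTensorEnd`** — for ANY ranks and ANY archimedean pair element,
  `cmPairRep hGR (x_∞, y_∞) = cmArchWeilRep hGR (x, y) ⊗ 1` as OPERATORS on `𝒮(𝔸^n)` (binder-2's (J-a)
  `HypCensus/ArchDatumCM.omega_cmPairSplitting_arch_map_tmul` on pure tensors + `linearMap_ext_tensor`), its scalar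
  form, and `isArchTensor_of_eq_smul_cmPairRep_archToAdelic` — every representation that is pointwise a scalar times
  `cmPairRep` at archimedean pair elements is `IsArchTensor` (`Model/ArchKTypePinTensor`);
* § 2 **the frame transport of an archimedean element is archimedean**: `finPart (cmKTypeHom g (x_∞, 1)) = 1`
  (`g_𝔸⁻¹ (x_∞, 1_f) g_𝔸` has finite part `g_f⁻¹ g_f = 1`), hence the ARCHIMEDEAN frame transport
  `archFrameCongr : U(H)(L ⊗ ℝ) →* U(diag d)(L ⊗ ℝ)` with `(archFrameCongr x)_𝔸 = cmKTypeHom g (x_𝔸)`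
  (`archToAdelic_archFrameCongr`);
* § 3 at the pin objects: **`archSectionFrameOf V : U21 →* U(diag (frameD V))(L ⊗ ℝ)`** — #1097's section
  `archSectionU21CM L ι₁ V.Hm V.sylvesterFrame _` moved to the rational CM frame of record (`frameG V`, `WmInstanceV2`),
  with `cmFrameEquiv (frameG V) V.Hm (frameD V) _ (archSectionU21CM … u) = (archSectionFrameOf V u)_𝔸`
  (`cmFrameEquiv_archSectionU21CM`) — so that, at the honest `S`, `hA` holds with
  `ωA u := c_k(u) • cmArchWeilRep e₁ hGR_k (archSectionFrameOf V u, 1)`.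

Nothing is cited and nothing is minted: kernel lemmas and two `MonoidHom` compositions over installed RUN-36 modules;
0 records, 0 `def … : Prop`.
-/

set_option autoImplicit false

noncomputable section

open NumberField NumberField.mixedEmbedding IsDedekindDomain
open scoped Matrix TensorProduct Classical SchwartzMap
open Literature.Geometry.ComplexHyperbolic.BallModel (U21)
open Literature.NumberTheory.Automorphic Literature.NumberTheory.Weil1964
open Literature.NumberTheory.GelbartRogawski1991 Literature.NumberTheory.GelbartRogawski1991.UnitaryDualPair
open HodgeCM.Model.HypCensus

namespace HodgeCM
namespace Model

/-! ### § 1. `cmPairRep` at archimedean pair elements is `cmArchWeilRep ⊗ 1` -/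

section ArchTensor

variable (L : Type) [Field L] [NumberField L] [IsCMField L] {N M n : ℕ} (e : Fin N × Fin M ≃ Fin n)
variable (dV : Fin N → L) (hdV : ∀ i, IsCMField.complexConj L (dV i) = dV i) (hdV0 : ∀ i, dV i ≠ 0)
variable (dW : Fin M → L) (hdW : ∀ i, IsCMField.complexConj L (dW i) = dW i) (hdW0 : ∀ i, dW i ≠ 0)
variable (hGR : (cmSplittingDatum L e dV hdV hdV0 dW hdW hdW0).CompatibleSplitting)

/-- `(c · A) ⊗ B = c · (A ⊗ B)`. -/
theorem adelicTensorEnd_smul_left {K : Type} [Field K] [NumberField K] {ι : Type} [Fintype ι] (c : ℂ)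
    (A : 𝓢((ι → mixedSpace K), ℂ) →ₗ[ℂ] 𝓢((ι → mixedSpace K), ℂ)) (B : FinSB K ι →ₗ[ℂ] FinSB K ι) :
    adelicTensorEnd (c • A) B = c • adelicTensorEnd A B := by
  simp only [adelicTensorEnd, TensorProduct.map_smul_left, LinearMap.smul_comp, LinearMap.comp_smul]

/-- **`cmPairRep hGR (x_∞, y_∞) = cmArchWeilRep hGR (x, y) ⊗ 1`** as operators on `𝒮(𝔸_{L⁺}^n)`: the pair action of
the CM pin at an archimedean pair element is pure-tensor with archimedean factor binder-2's `cmArchWeilRep`. -/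
theorem cmPairRep_archToAdelic_eq_adelicTensorEnd
    (x : UnitaryGroup.arch (↥(maximalRealSubfield L)) L (IsCMField.complexConj L) N (Matrix.diagonal dV))
    (y : UnitaryGroup.arch (↥(maximalRealSubfield L)) L (IsCMField.complexConj L) M (Matrix.diagonal dW)) :
    cmPairRep L e dV hdV hdV0 dW hdW hdW0 hGR
        (UnitaryGroup.archToAdelic (↥(maximalRealSubfield L)) L (IsCMField.complexConj L) N (Matrix.diagonal dV) x,
          UnitaryGroup.archToAdelic (↥(maximalRealSubfield L)) L (IsCMField.complexConj L) M (Matrix.diagonal dW) y) =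
      adelicTensorEnd (cmArchWeilRep L e dV hdV hdV0 dW hdW hdW0 hGR (x, y) :
        𝓢((Fin n → mixedSpace (↥(maximalRealSubfield L))), ℂ) →ₗ[ℂ] _) LinearMap.id :=
  linearMap_ext_tensor fun Φinf f => by
    rw [cmPairRep_apply, omega_cmPairSplitting_arch_map_tmul, adelicTensorEnd_apply_tmul, LinearMap.id_apply]

/-- Scalar form: `c • cmPairRep hGR (x_∞, y_∞) = (c • cmArchWeilRep hGR (x, y)) ⊗ 1`. -/
theorem smul_cmPairRep_archToAdelic_eq_adelicTensorEnd (c : ℂ)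
    (x : UnitaryGroup.arch (↥(maximalRealSubfield L)) L (IsCMField.complexConj L) N (Matrix.diagonal dV))
    (y : UnitaryGroup.arch (↥(maximalRealSubfield L)) L (IsCMField.complexConj L) M (Matrix.diagonal dW)) :
    c • cmPairRep L e dV hdV hdV0 dW hdW hdW0 hGR
        (UnitaryGroup.archToAdelic (↥(maximalRealSubfield L)) L (IsCMField.complexConj L) N (Matrix.diagonal dV) x,
          UnitaryGroup.archToAdelic (↥(maximalRealSubfield L)) L (IsCMField.complexConj L) M (Matrix.diagonal dW) y) =
      adelicTensorEnd (c • (cmArchWeilRep L e dV hdV hdV0 dW hdW hdW0 hGR (x, y) :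
        𝓢((Fin n → mixedSpace (↥(maximalRealSubfield L))), ℂ) →ₗ[ℂ] _)) LinearMap.id := by
  rw [adelicTensorEnd_smul_left, cmPairRep_archToAdelic_eq_adelicTensorEnd]

/-- **`IsArchTensor` for every representation that is a scalar times `cmPairRep` at archimedean pair elements**:
if `ρ g = c g • cmPairRep hGR ((φ g).1_∞, (φ g).2_∞)` for all `g`, then `ρ` is pure-tensor along the archimedean factor
(witness `c g • cmArchWeilRep hGR (φ g)`).  This is the shape of the honest `(S.P k).ω ∘ (S.ιinf ·, 1)` after the line
collapse (tree `cm(Conj)LineRepFin_k_apply_eq_smul_cmPairRep` at `t = 1`) and § 3 below. -/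
theorem isArchTensor_of_eq_smul_cmPairRep_archToAdelic {G : Type*} [Monoid G]
    (ρ : Representation ℂ G (piSchwartzBruhat (↥(maximalRealSubfield L)) (Fin n))) (c : G → ℂ)
    (φ : G → UnitaryGroup.arch (↥(maximalRealSubfield L)) L (IsCMField.complexConj L) N (Matrix.diagonal dV) ×
      UnitaryGroup.arch (↥(maximalRealSubfield L)) L (IsCMField.complexConj L) M (Matrix.diagonal dW))
    (h : ∀ g, ρ g = c g • cmPairRep L e dV hdV hdV0 dW hdW hdW0 hGR
      (UnitaryGroup.archToAdelic (↥(maximalRealSubfield L)) L (IsCMField.complexConj L) N (Matrix.diagonal dV) (φ g).1,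
        UnitaryGroup.archToAdelic (↥(maximalRealSubfield L)) L (IsCMField.complexConj L) M (Matrix.diagonal dW) (φ g).2)) :
    IsArchTensor ρ := fun g =>
  ⟨c g • (cmArchWeilRep L e dV hdV hdV0 dW hdW hdW0 hGR (φ g) : 𝓢((Fin n → mixedSpace (↥(maximalRealSubfield L))), ℂ) →ₗ[ℂ] _),
    by rw [h g, smul_cmPairRep_archToAdelic_eq_adelicTensorEnd]⟩

end ArchTensor

/-! ### § 2. The frame transport of an archimedean element is archimedean -/

section Frame

variable (L : Type) [Field L] [NumberField L] [IsCMField L] {N : ℕ} (H : Matrix (Fin N) (Fin N) L)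
  (g : GL (Fin N) L) (d : Fin N → L)
  (hg : ((g : Matrix (Fin N) (Fin N) L).map (cmConjRingHom L))ᵀ * H * (g : Matrix (Fin N) (Fin N) L) = Matrix.diagonal d)

/-- **`(g_𝔸⁻¹ (x_∞, 1_f) g_𝔸)_f = 1`**: the frame transport `cmKTypeHom g` of an archimedean element of `U(H)(𝔸_{L⁺})` has
trivial finite part. -/
theorem finPart_cmKTypeHom_archToAdelic
    (x : UnitaryGroup.arch (↥(maximalRealSubfield L)) L (IsCMField.complexConj L) N H) :
    UnitaryGroup.finPart (↥(maximalRealSubfield L)) L (IsCMField.complexConj L) N (Matrix.diagonal d)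
        (cmKTypeHom L H g d hg
          (UnitaryGroup.archToAdelic (↥(maximalRealSubfield L)) L (IsCMField.complexConj L) N H x)) = 1 := by
  apply Subtype.ext
  rw [UnitaryGroup.coe_finPart, OneMemClass.coe_one]
  change GLn.sndHom N L ((cmKTypeHom L H g d hg
      (UnitaryGroup.archToAdelic (↥(maximalRealSubfield L)) L (IsCMField.complexConj L) N H x) :
        ↥(UnitaryGroup.adelic (↥(maximalRealSubfield L)) L (IsCMField.complexConj L) N (Matrix.diagonal d))) :
          GL (Fin N) (AdeleRing (𝓞 L) L)) = 1
  rw [coe_cmKTypeHom, map_mul, map_mul, map_inv]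
  change (GLn.sndHom N L (toAdeleGL L g))⁻¹ *
      GLn.sndHom N L (GLn.ofInfinite N L (x : GL (Fin N) (mixedSpace L))) * GLn.sndHom N L (toAdeleGL L g) = 1
  rw [GLn.sndHom_ofInfinite, mul_one, inv_mul_cancel]

/-- **The ARCHIMEDEAN frame transport** `U(H)(L ⊗ ℝ) →* U(diag d)(L ⊗ ℝ)`, `x ↦ (g_𝔸⁻¹ (x, 1) g_𝔸)_∞ = g_∞⁻¹ x g_∞`. -/
def archFrameCongr :
    UnitaryGroup.arch (↥(maximalRealSubfield L)) L (IsCMField.complexConj L) N H →*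
      UnitaryGroup.arch (↥(maximalRealSubfield L)) L (IsCMField.complexConj L) N (Matrix.diagonal d) :=
  (UnitaryGroup.archPart (↥(maximalRealSubfield L)) L (IsCMField.complexConj L) N (Matrix.diagonal d)).comp
    ((cmKTypeHom L H g d hg).comp
      (UnitaryGroup.archToAdelic (↥(maximalRealSubfield L)) L (IsCMField.complexConj L) N H))

/-- (Ported verbatim from the HodgeCMPerL package; no docstring in the source.) -/
theorem archFrameCongr_apply (x : UnitaryGroup.arch (↥(maximalRealSubfield L)) L (IsCMField.complexConj L) N H) :
    archFrameCongr L H g d hg x =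
      UnitaryGroup.archPart (↥(maximalRealSubfield L)) L (IsCMField.complexConj L) N (Matrix.diagonal d)
        (cmKTypeHom L H g d hg
          (UnitaryGroup.archToAdelic (↥(maximalRealSubfield L)) L (IsCMField.complexConj L) N H x)) :=
  rfl

/-- **`(archFrameCongr x)_𝔸 = g_𝔸⁻¹ x_𝔸 g_𝔸`**: the frame transport of an archimedean element IS archimedean. -/
theorem archToAdelic_archFrameCongr
    (x : UnitaryGroup.arch (↥(maximalRealSubfield L)) L (IsCMField.complexConj L) N H) :
    UnitaryGroup.archToAdelic (↥(maximalRealSubfield L)) L (IsCMField.complexConj L) N (Matrix.diagonal d)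
        (archFrameCongr L H g d hg x) =
      cmKTypeHom L H g d hg (UnitaryGroup.archToAdelic (↥(maximalRealSubfield L)) L (IsCMField.complexConj L) N H x) := by
  have h := UnitaryGroup.archToAdelic_mul_finAdelicToAdelic (↥(maximalRealSubfield L)) L (IsCMField.complexConj L) N
    (Matrix.diagonal d)
    (cmKTypeHom L H g d hg (UnitaryGroup.archToAdelic (↥(maximalRealSubfield L)) L (IsCMField.complexConj L) N H x))
  rwa [finPart_cmKTypeHom_archToAdelic, map_one, mul_one] at h

end Frame

/-! ### § 3. The `ι₁`-section of #1097 in the rational CM frame of record -/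

section PinSection

variable {L : CMField} {ι₁ : L →+* ℂ} (V : HermSpace3 L ι₁)

/-- **The `ι₁`-archimedean section as an element of `U(V.Hm)(L ⊗ ℝ)`**: the archimedean part of #1097's
`archSectionU21CM L ι₁ V.Hm V.sylvesterFrame _` (`u ↦ (T u T⁻¹ un-twisted at w(ι₁), 1 at the other places)`). -/
def archSectionArchOf :
    U21 →* UnitaryGroup.arch (↥(maximalRealSubfield L)) L (IsCMField.complexConj L) 3 V.Hm :=
  (UnitaryGroup.archPart (↥(maximalRealSubfield L)) L (IsCMField.complexConj L) 3 V.Hm).comp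
    (UnitaryGroup.archSectionU21CM (L : Type) ι₁ V.Hm V.sylvesterFrame (sylvesterFrame_J V))

/-- #1097's section IS archimedean: `(archSectionArchOf V u)_𝔸 = archSectionU21CM … u`. -/
theorem archToAdelic_archSectionArchOf (u : U21) :
    UnitaryGroup.archToAdelic (↥(maximalRealSubfield L)) L (IsCMField.complexConj L) 3 V.Hm (archSectionArchOf V u) =
      UnitaryGroup.archSectionU21CM (L : Type) ι₁ V.Hm V.sylvesterFrame (sylvesterFrame_J V) u := by
  simp only [archSectionArchOf, MonoidHom.comp_apply, UnitaryGroup.archSectionU21CM,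
    UnitaryGroup.archSectionU21Emb_apply, UnitaryGroup.adelicSingle_apply, UnitaryGroup.archPart_archToAdelic]
  rfl

/-- **The `ι₁`-section in the rational CM frame of record** `frameG V` (`ᵗ(σ g) · V.Hm · g = diag (frameD V)`,
`Model/WmInstanceV2`): `U(2,1) →* U(diag (frameD V))(L ⊗ ℝ)`, `u ↦ g_∞⁻¹ · (archSectionArchOf V u) · g_∞`. -/
def archSectionFrameOf :
    U21 →* UnitaryGroup.arch (↥(maximalRealSubfield L)) L (IsCMField.complexConj L) 3 (Matrix.diagonal (frameD V)) :=
  (archFrameCongr (L : Type) V.Hm (frameG V) (frameD V) (frame_congr V)).comp (archSectionArchOf V)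

/-- (Ported verbatim from the HodgeCMPerL package; no docstring in the source.) -/
theorem archSectionFrameOf_apply (u : U21) :
    archSectionFrameOf V u = archFrameCongr (L : Type) V.Hm (frameG V) (frameD V) (frame_congr V) (archSectionArchOf V u) :=
  rfl

/-- **`cmFrameEquiv (frameG V) (archSectionU21CM … u) = (archSectionFrameOf V u)_𝔸`**: the frame transport of record
(the first factor of period-1's `lineRepOf k`) takes #1097's `ι₁`-section to an ARCHIMEDEAN element of
`U(diag (frameD V))(𝔸_{L⁺})` — the input shape of § 1 / binder-2's (J-a). -/
theorem cmFrameEquiv_archSectionU21CM (u : U21) :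
    cmFrameEquiv (L : Type) (frameG V) V.Hm (frameD V) (frame_congr V)
        (UnitaryGroup.archSectionU21CM (L : Type) ι₁ V.Hm V.sylvesterFrame (sylvesterFrame_J V) u) =
      UnitaryGroup.archToAdelic (↥(maximalRealSubfield L)) L (IsCMField.complexConj L) 3 (Matrix.diagonal (frameD V))
        (archSectionFrameOf V u) := by
  rw [archSectionFrameOf_apply, archToAdelic_archFrameCongr, archToAdelic_archSectionArchOf, cmKTypeHom_apply]
  rfl

end PinSection

end Model
end HodgeCM

end
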